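import Summits.BirchSwinnertonDyer.Rank1Residual.Additive.SignedTwistPlusDisjoint
import Summits.BirchSwinnertonDyer.Rank1Residual.Additive.SignedTwistLocalDictionary
import HarnessLib

/-!
# The PLUS local points dictionary of the signed-`η` twist, both ways:
# `E⁺_W(n) ≅ E⁺_V(K₀ℚ_n·E)^{η}` under `Ψ` (cell `bsd-potss`, seat `bsd-potss-ctrl` g2; first brick
# of T-e2-R1⁺ = the plus twin of x1b's minus P5 series `SignedTwistLocalDictionary` (D4b2) /
# `SignedTwistKummerDictionary` / `SignedTwistSelmerInfty(Eta)` / `SignedTwistDualTransport`, whose end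
# is «X⁺(V/K_∞)^η IS X⁺_W(ℚ_∞)» and hence the discharge of the reading (R1⁺)
# `EvenBranchPlusCharIdealOfPlusMCAt` from Kobayashi's even main conjecture at `η` — TARGET.md v6
# §0.12 (e), planner's next task for this seat)

HONEST FRAMING (cell `bsd-potss`, run/shared/lean/pub/bsd-potss/; FULL-BSD rank ≤ 1 programme,
tranche 1b): TOOL THEOREMS ONLY — no definition, no named Literature fact, no Summits-side fact
`def … : Prop`, no `sorry`, axioms standard; generic binders (`hD`, `hκ₀`) exactly as x1b's (D4b2);
nothing is booked; no label / mark / count moves; nothing about (C1_η) or `BSD(W, p)` is claimed.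

## What (setting of x1b's `SignedTwistTraceDictionary` §6: `Ψ = localTransport`, `K₀ ∋ θ = √c`,
## `V = C • W^{(c)}`, `η` the character of `θ`, `κ` the `ℤ_p`-extension, `U_n = towerSubgroup κ K₀ n`)

* `localTransport_symm_mem_signed_one_of_eigen` — (D4b2⁺): an `η`-EIGEN point of cc-typer-6's PLUS
  group `E⁺_V(K₀ℚ_n·E)` (`towerSignedLocalPointsOfEmb U ι V 1 n`) pulls back under `Ψ` into
  Kobayashi's Def. 1.1 PLUS group `E⁺_W(n)` (`signedLocalPointsOfEmb κ ι W 1 n`): its traces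
  `Tr^W_{n/m+1}`, `m` even, are fixed by `Gal(ℚ̄_E/K₀ℚ_m·E)` (trace dictionary (D4a)) and by
  `Gal(ℚ̄_E/ℚ_∞·E)`, hence by `Gal(ℚ̄_E/ℚ_m·E)` — word for word x1b's minus (D4b2) WITHOUT the
  `m = −1` clause (the plus side has none, so no `2 • Tr_{n/0} = 0` / zero-clause subtlety arises).
* `mem_signedLocalPointsOfEmb_one_iff_localTransport_mem` — the dictionary as an `iff` on
  `W(ℚ_n·E)`: for `P ∈ W(ℚ_n·E)`, `P ∈ E⁺_W(n) ↔ Ψ P ∈ E⁺_V(K₀ℚ_n·E)` ((D4b1⁺) of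
  `SignedTwistPlusDisjoint` for `→`; the above with the automatic `η`-eigen property
  `localTransport_mem_localFixedPoints_and_eigen` for `←`).

References: [Kobayashi2003] S. Kobayashi, Invent. Math. 152 (2003), §2 p. 4, Def. 1.1 (p. 2),
§4 p. 8 (`M^η = ε_η M`).
-/

noncomputable section

open scoped Classical

open WeierstrassCurve Field

namespace Summit.BirchSwinnertonDyer.Rank1Residual.Additive.SignedTwist

open Literature.NumberTheory.EllipticCurves Literature.NumberTheory.GaloisRepresentations
  Literature.NumberTheory.EllipticCurves.Kobayashi2003
  Summit.BirchSwinnertonDyer.Rank1Residual.AdditivePotMult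

section PlusDictionary

open ZpExtension

variable (W : WeierstrassCurve ℚ) (K₀ : Type) [Field K₀] [NumberField K₀] {θ : K₀} {c : ℚ}
  (hθ : θ ∉ Set.range (algebraMap ℚ K₀)) (hc : θ ^ 2 = algebraMap ℚ K₀ c)
  {p : ℕ} [Fact p.Prime] (κ : ZpExtension ℚ p)
  {V : WeierstrassCurve ℚ} {C : VariableChange ℚ} (hCV : C • W.quadraticTwist c = V)
  {E : Type} [Field E] [Algebra ℚ E] (ι : AlgebraicClosure ℚ →ₐ[ℚ] AlgebraicClosure E)
  (η : absoluteGaloisGroup ℚ →* ℤˣ)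
  (hη : ∀ σ : absoluteGaloisGroup ℚ, η σ = 1 ↔ σ • rootInClosure K₀ θ = rootInClosure K₀ θ)

include hη in
/-- **(D4b2⁺) `E⁺_V(K_n)^{η} → E⁺_W(n)`**: an `η`-eigen point of cc-typer-6's PLUS group pulls back
into Kobayashi's Def. 1.1 plus group in `W`-coordinates: its traces `Tr^W_{n/m+1}`, `m` even, are
fixed by `Gal(ℚ̄_E/K₀ℚ_m·E)` (dictionary (D4a)) and by `Gal(ℚ̄_E/ℚ_∞·E)` (they lie in layer
`m+1`), hence by `Gal(ℚ̄_E/ℚ_m·E)` ((D0)(i)). The plus twin of x1b's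
`localTransport_symm_mem_signed_of_eigen` (no `m = −1` clause on the plus side).
[cite: Kobayashi2003, §2 p. 4, Def. 1.1 (p. 2)] -/
theorem localTransport_symm_mem_signed_one_of_eigen
    (hD : ∀ g : absoluteGaloisGroup ℚ, ∃ τ : absoluteGaloisGroup E,
      (resGalOfEmb ι τ)⁻¹ * g ∈ towerTopSubgroup κ K₀)
    (hκ₀ : ∀ x, ∃ g ∈ galRange (K := ℚ) K₀, κ g = x) {n : ℕ} {S : localPoints V E}
    (hS : S ∈ towerSignedLocalPointsOfEmb (towerSubgroup κ K₀) ι V 1 n)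
    (hSη : ∀ τ ∈ localLayerSubgroupOfEmb κ ι n,
      τ • S = ((η (resGalOfEmb ι τ) : ℤˣ) : ℤ) • S) :
    (localTransport W K₀ hθ hc hCV E ι).symm S ∈ signedLocalPointsOfEmb κ ι W 1 n := by
  set Q := (localTransport W K₀ hθ hc hCV E ι).symm S with hQ
  have hQn : Q ∈ localLayerPointsOfEmb κ ι W n :=
    localTransport_symm_mem_localLayerPointsOfEmb W K₀ hθ hc κ hCV ι η hη hSη
  have hΨQ : localTransport W K₀ hθ hc hCV E ι Q = S := AddEquiv.apply_symm_apply _ _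
  obtain ⟨-, hSeven, -⟩ := (mem_towerSignedLocalPointsOfEmb_iff _ ι V 1 n S).mp hS
  refine (mem_signedLocalPointsOfEmb_iff κ ι W 1 n Q).mpr ⟨hQn, fun m hm hε ↦ ?_⟩
  set R := localTraceOfEmb κ ι W (m + 1) n Q
  have hRV : localTransport W K₀ hθ hc hCV E ι R ∈
      localFixedPointsOfEmb ι V (towerSubgroup κ K₀ m) := by
    rw [localTransport_localTraceOfEmb W K₀ hθ hc κ hCV ι hD hκ₀ (m + 1) n hQn, hΨQ]
    exact hSeven m hm hε
  have hRU : R ∈ localFixedPointsOfEmb ι W (towerSubgroup κ K₀ m) := by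
    have h := localTransport_symm_mem_localFixedPointsOfEmb W K₀ hθ hc hCV ι
      (towerSubgroup_le_galRange κ K₀ m) hRV
    rwa [AddEquiv.symm_apply_apply] at h
  exact mem_localLayerPointsOfEmb_of_tower_of_ker W K₀ κ ι hD hκ₀ hRU
    (mem_localFixedPointsOfEmb_ker_of_mem_layer W κ ι (localTraceOfEmb_mem_of_mem κ ι W (m + 1) n hQn))

include hη in
/-- **The plus points dictionary as an `iff` on `W(ℚ_n·E)`**: for `P ∈ W(ℚ_n·E)`,
`P ∈ E⁺_W(n) ↔ Ψ P ∈ E⁺_V(K₀ℚ_n·E)` — `→` is (D4b1⁺) (`localTransport_mem_towerSigned_one`), `←` is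
(D4b2⁺) with the `η`-eigen property of `Ψ P` automatic (`localTransport_mem_localFixedPoints_and_eigen`).
So `Ψ` restricts to `E⁺_W(n) ≅ E⁺_V(K₀ℚ_n·E)^{η-eigen}` — the point-level form of
«`E⁺(V/K_n)^η` IS `E⁺_W(ℚ_n)`». [cite: Kobayashi2003, §2 p. 4, Def. 1.1 (p. 2), §4 p. 8] -/
theorem mem_signedLocalPointsOfEmb_one_iff_localTransport_mem
    (hD : ∀ g : absoluteGaloisGroup ℚ, ∃ τ : absoluteGaloisGroup E,
      (resGalOfEmb ι τ)⁻¹ * g ∈ towerTopSubgroup κ K₀)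
    (hκ₀ : ∀ x, ∃ g ∈ galRange (K := ℚ) K₀, κ g = x) {n : ℕ} {P : localPoints W E}
    (hP : P ∈ localLayerPointsOfEmb κ ι W n) :
    P ∈ signedLocalPointsOfEmb κ ι W 1 n ↔
      localTransport W K₀ hθ hc hCV E ι P ∈ towerSignedLocalPointsOfEmb (towerSubgroup κ K₀) ι V 1 n := by
  refine ⟨fun h ↦ localTransport_mem_towerSigned_one W K₀ hθ hc κ hCV ι hD hκ₀ h, fun h ↦ ?_⟩
  have hPη := (localTransport_mem_localFixedPoints_and_eigen W K₀ hθ hc κ hCV ι η hη hP).2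
  have h' := localTransport_symm_mem_signed_one_of_eigen W K₀ hθ hc κ hCV ι η hη hD hκ₀ h hPη
  rwa [AddEquiv.symm_apply_apply] at h'

end PlusDictionary

end Summit.BirchSwinnertonDyer.Rank1Residual.Additive.SignedTwist

end
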